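import Literature.NumberTheory.DiophantineGeometry.FreyCurveConductorTwoTwistDichotomyProofs
import Literature.NumberTheory.EllipticCurves.SzpiroFreyConductorProofs
import Literature.NumberTheory.DiophantineGeometry.MinimalDiscriminantFactorizationProofs
import HarnessLib

/-!
# The normalised Frey–Hellegouarch curve `y² = x(x − A)(x + B)`, `A ≡ −1 (4)`, `B` even:
# `N_E ∣ 2⁴ rad(ABC)`, the exact `2`-exponent (Diamond–Kramer), and `Δ_E = 2⁴(ABC)²` or `2⁻⁸(ABC)²`
# (von Känel–Matschke 2016/2023, proof of Lemma 10.5 and (eq:refinedcondbound))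

Topic `Literature/NumberTheory/EllipticCurves` (family `abc`, LADDER-ABC A1: the *modular method*).
A proofs-only file (theorems only; NO definition, NO new named fact, nothing restated; D-0026)
serving the discharge of the named fact
`Literature.NumberTheory.EllipticCurves.ModularForms.vonKanelMatschke_lemma_10_5`
(R. von Känel, B. Matschke, arXiv:1605.06079 = Mem. AMS **286** (2023) no. 1419
[`VonkanelMatschke2023`], Lemma 10.5 = `lem:psu2` and the remark (eq:refinedcondbound)). It proves
the first half of the printed proof (arXiv p. 59–60), about the curve `E`:

*"`(A, B, C)` has the following properties: `A, B, C` are coprime, `A = −1 (mod 4)`, `B` is even,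
`A + B = C` … Thus [Diamond–Kramer] give that the conductor `N_E` of `E` divides `2⁴ rad(abc)` … the
minimal discriminant `Δ_E` of `E` satisfies `Δ_E = Δ` [`= 2⁴(ABC)²`] if `ord₂(abc) ≤ 3`, and
`Δ_E = 2⁻⁸(abc)²` if `ord₂(abc) ≥ 4`"*, and *"the conductor `N_E` of `E` satisfies
`ord₂(N_E) = 𝔢 + 1`"* with `𝔢 = 4, 2, 2, −1, 0` for `ord₂(abc) = 1, 2, 3, 4, ≥ 5`.

Everything is assembled from the tree's PROVED Diamond–Kramer rows and Bombieri–Gubler models of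
the Frey curve `freyCurve A B` (`EllipticCurves/Szpiro`):

* rows `t = 5` (`ord₂B = 1`) and `t = 3` (`ord₂B ∈ {2, 3}`):
  `factorization_two_conductorNorm_freyCurve_of_not_four_dvd`, `…_of_four_dvd`
  (`FreyCurveConductorTwoTwistDichotomyProofs`; Tate's algorithm at `2` in the tree);
* row `t = 1` (`ord₂B ≥ 5`): `N_E = rad(ABC)` (`conductorNorm_freyCurve_of_mod_holds`, Serre's
  normalisation `32 ∣ B`);
* row `t = 0` (`ord₂B = 4`): proved here — B–G's equation (12.18) `freyIntModel₂ A B` is minimal at `2`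
  (`isMinimalAt_freyIntModel₂`) with odd discriminant `(AB/16)²(A+B)²`, so `f₂ = 0`
  (`conductorExponent_eq_zero_of_not_dvd_Δ`, conductor invariance `conductor_smul`);
* `N_E ∣ 2⁸ rad(ABC)` (`conductorNorm_freyCurve_dvd_holds`), sharpened to `2⁴` by `t ≤ 5`;
* `Δ_E`: the global minimal equations (12.17) `freyIntModel` (`16 ∤ ABC`) and (12.18)
  `freyIntModel₂` (`16 ∣ B`) with `minimalDiscriminantNorm_eq_natAbs_holds`.

No `abc` claim; typed ≠ endorsed. All theorems; axioms standard.

## References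

* R. von Känel, B. Matschke, arXiv:1605.06079 (2016) = Mem. AMS 286 (2023), Lemma 10.5, its proof
  and (eq:refinedcondbound), §10.4 (arXiv numbering). [VonkanelMatschke2023]
* F. Diamond, K. Kramer, *Modularity of a family of elliptic curves*, Math. Res. Lett. 2 (1995)
  299–304. [DiamondKramer1995]
* E. Bombieri, W. Gubler, *Heights in Diophantine Geometry* (2006), Ex. 12.5.10. [BombieriGubler2006]
-/

noncomputable section

open IsDedekindDomain WeierstrassCurve Rat.HeightOneSpectrum UniqueFactorizationMonoid
open Literature.NumberTheory.DiophantineGeometry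

namespace Literature.NumberTheory.EllipticCurves

section Normalised

variable {A B : ℤ}

/-! ### Arithmetic of the normalisation `A ≡ −1 (mod 4)`, `2 ∣ B` -/

/-- `A ≡ −1 (mod 4)` means `4 ∣ A + 1`. [folklore] -/
private theorem four_dvd_add_one (hA : A ≡ -1 [ZMOD 4]) : 4 ∣ A + 1 := by
  have := Int.ModEq.dvd hA.symm
  simpa [sub_neg_eq_add] using this

/-- For `A ≡ −1 (mod 4)` and `16 ∣ B`: `4 ∣ B − A − 1`. [folklore] -/
private theorem four_dvd_sub (hA : A ≡ -1 [ZMOD 4]) (hB : (16 : ℤ) ∣ B) : 4 ∣ B - A - 1 := by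
  have : B - A - 1 = B - (A + 1) := by ring
  rw [this]
  exact dvd_sub (dvd_trans (by norm_num) hB) (four_dvd_add_one hA)

/-- `A ≡ −1 (mod 4)` is odd. [folklore] -/
private theorem not_two_dvd_of_mod (hA : A ≡ -1 [ZMOD 4]) : ¬ (2 : ℤ) ∣ A := by
  intro h2
  have h := hA.dvd
  omega

/-- For `A` odd and `B` even, `ord₂(AB(A+B)) = ord₂(B)` (read in `ℕ` on absolute values).
[folklore] -/
private theorem padicValNat_natAbs_prod_eq (h0 : A * B * (A + B) ≠ 0) (hA : ¬ (2 : ℤ) ∣ A)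
    (hB : (2 : ℤ) ∣ B) :
    padicValNat 2 (A * B * (A + B)).natAbs = padicValNat 2 B.natAbs := by
  haveI : Fact (Nat.Prime 2) := ⟨Nat.prime_two⟩
  have hA0 : A ≠ 0 := fun h ↦ h0 (by rw [h]; ring)
  have hB0 : B ≠ 0 := fun h ↦ h0 (by rw [h]; ring)
  have hC0 : A + B ≠ 0 := fun h ↦ h0 (by rw [h]; ring)
  have hC : ¬ (2 : ℤ) ∣ A + B := fun h ↦ hA (by simpa using dvd_sub h hB)
  have hA' : padicValInt 2 A = 0 := padicValInt.eq_zero_of_not_dvd (by exact_mod_cast hA)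
  have hC' : padicValInt 2 (A + B) = 0 := padicValInt.eq_zero_of_not_dvd (by exact_mod_cast hC)
  change padicValInt 2 (A * B * (A + B)) = padicValInt 2 B
  rw [padicValInt.mul (mul_ne_zero hA0 hB0) hC0, padicValInt.mul hA0 hB0, hA', hC']
  ring

/-- `ord₂(B) = 1` iff `2 ∣ B` and `4 ∤ B`, etc.: `2^k ∣ B ↔ k ≤ ord₂ B` for `B ≠ 0`. [folklore] -/
private theorem two_pow_dvd_iff (hB0 : B ≠ 0) (k : ℕ) :
    (2 : ℤ) ^ k ∣ B ↔ k ≤ padicValNat 2 B.natAbs := by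
  haveI : Fact (Nat.Prime 2) := ⟨Nat.prime_two⟩
  have h := padicValInt_dvd_iff (p := 2) k B
  push_cast at h
  rw [h]
  exact ⟨fun h' ↦ h'.resolve_left hB0, fun h' ↦ Or.inr h'⟩

/-! ### The `2`-exponent of the conductor: the four rows of Diamond–Kramer's table -/

/-- The conductor of `E_{A,B}` is that of B–G's equation (12.18) (`4 ∣ B − A − 1`, `16 ∣ AB`), a
`ℚ`-isomorphic equation (`conductor_smul`). [cite: BombieriGubler2006, Ex. 12.5.10 (12.18)] -/
theorem conductorNorm_freyCurve_eq_freyIntModel₂ (h0 : A * B * (A + B) ≠ 0) (h4 : 4 ∣ B - A - 1)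
    (h16 : 16 ∣ A * B) :
    (freyCurve A B).conductorNorm ℤ = ((freyIntModel₂ A B).baseChange ℚ).conductorNorm ℤ := by
  haveI := isElliptic_freyCurve h0
  have hC := smul_freyCurve_eq_baseChange_freyIntModel₂ h4 h16
  have hinv := conductor_smul ℤ (freyCurve A B) (fun v ↦ ordMinimalDiscriminant_smul_holds v _)
    (fun v ↦ kodairaSymbol_smul_holds _) (⟨Units.mk0 (2 : ℚ) two_ne_zero, 0, 1, 0⟩ : VariableChange ℚ)
  unfold conductorNorm
  rw [← hinv, hC]

/-- **Row `ord₂ B = 4`: `ord₂ N(E_{A,B}) = 0`** (`A ≡ −1 (mod 4)`, `16 ∥ B`, `A, B` coprime; type `I₀`,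
good reduction at `2`): B–G's (12.18) is minimal at `2` with odd discriminant `(AB/16)²(A+B)²`.
(Diamond–Kramer's row `t = 0`, quoted in Ribet 1997 §2; vKM (eq:refinedcondbound) `𝔢 = −1`.)
[cite: DiamondKramer1995] [cite: VonkanelMatschke2023, §10.4 (eq:refinedcondbound)] -/
theorem factorization_two_conductorNorm_freyCurve_of_sixteen_dvd (hAB : IsCoprime A B)
    (h0 : A * B * (A + B) ≠ 0) (hA : A ≡ -1 [ZMOD 4]) (h16 : (16 : ℤ) ∣ B) (h32 : ¬ (32 : ℤ) ∣ B) :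
    ((freyCurve A B).conductorNorm ℤ).factorization 2 = 0 := by
  have h4 := four_dvd_sub hA h16
  have h16' : 16 ∣ A * B := dvd_mul_of_dvd_right h16 _
  haveI := isElliptic_freyIntModel₂ h0 h4 h16'
  rw [conductorNorm_freyCurve_eq_freyIntModel₂ h0 h4 h16', factorization_two_conductorNorm]
  refine conductorExponent_eq_zero_of_not_dvd_Δ
    (isMinimalAt_freyIntModel₂ hAB (four_dvd_add_one hA) h16 _) ?_
  rw [Literature.NumberTheory.EllipticCurves.Rat.natGenerator_primesEquiv_symm ⟨2, Nat.prime_two⟩,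
    freyIntModel₂_Δ h4 h16']
  -- `(AB/16)² (A+B)²` is odd
  obtain ⟨e, he⟩ := h16
  have he' : A * B / 16 = A * e := by
    rw [he, show A * (16 * e) = 16 * (A * e) by ring]; simp
  have hA2 : ¬ (2 : ℤ) ∣ A := not_two_dvd_of_mod hA
  have he2 : ¬ (2 : ℤ) ∣ e := fun ⟨f, hf⟩ ↦ h32 ⟨f, by rw [he, hf]; ring⟩
  have hC2 : ¬ (2 : ℤ) ∣ A + B := by
    intro h; apply hA2
    have : A = (A + B) - 16 * e := by rw [he]; ring
    rw [this]; exact dvd_sub h (dvd_mul_of_dvd_left (by norm_num) _)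
  rw [he']
  push_cast
  intro h
  rcases Int.prime_two.dvd_or_dvd h with h | h
  · rcases Int.prime_two.dvd_or_dvd (Int.prime_two.dvd_of_dvd_pow h) with h | h
    · exact hA2 h
    · exact he2 h
  · exact hC2 (Int.prime_two.dvd_of_dvd_pow h)

/-- `(rad n).natAbs = rad |n|` for an integer `n`. [folklore] -/
private theorem natAbs_radical (n : ℤ) : (radical n).natAbs = radical n.natAbs := by
  rw [← Int.radical_natAbs_eq_radical, Int.natAbs_natCast]

/-- The exponent of `2` in `rad(n)` is `1` when `n ≠ 0` is even. [folklore] -/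
private theorem factorization_two_radical {n : ℕ} (hn : n ≠ 0) (h2 : 2 ∣ n) :
    (radical n).factorization 2 = 1 := by
  apply le_antisymm (squarefree_radical.natFactorization_le_one 2)
  refine Nat.Prime.factorization_pos_of_dvd Nat.prime_two radical_ne_zero ?_
  exact (Nat.mem_primeFactors.mp ((Nat.primeFactors_radical n).symm ▸
    Nat.mem_primeFactors.mpr ⟨Nat.prime_two, h2, hn⟩)).2.1

/-- **Row `ord₂ B ≥ 5`: `ord₂ N(E_{A,B}) = 1`** (`A ≡ −1 (mod 4)`, `32 ∣ B`, `A, B` coprime;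
multiplicative reduction at `2`): `N = rad(AB(A+B))` exactly (`conductorNorm_freyCurve_of_mod_holds`,
Serre 1987 §4.1 Prop. 6) and `AB(A+B)` is even. (Diamond–Kramer's row `t = 1`; vKM
(eq:refinedcondbound) `𝔢 = 0`.) [cite: DiamondKramer1995]
[cite: VonkanelMatschke2023, §10.4 (eq:refinedcondbound)] -/
theorem factorization_two_conductorNorm_freyCurve_of_thirtytwo_dvd (hAB : IsCoprime A B)
    (h0 : A * B * (A + B) ≠ 0) (hA : A ≡ -1 [ZMOD 4]) (h32 : (32 : ℤ) ∣ B) :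
    ((freyCurve A B).conductorNorm ℤ).factorization 2 = 1 := by
  rw [conductorNorm_freyCurve_of_mod_holds A B hAB h0 hA h32, natAbs_radical]
  refine factorization_two_radical (Int.natAbs_ne_zero.mpr h0) ?_
  have : (2 : ℤ) ∣ A * B * (A + B) :=
    dvd_mul_of_dvd_left (dvd_mul_of_dvd_right (dvd_trans (by norm_num) h32) _) _
  exact Int.ofNat_dvd_left.mp this

/-- **The `2`-exponent of `N(E_{A,B})` in all four rows** (`A, B` coprime, `AB(A+B) ≠ 0`,
`A ≡ −1 (mod 4)`, `B` even), indexed by `ord₂(AB(A+B)) = ord₂(B)`: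
`ord₂ N = 5, 3, 3, 0, 1` for `ord₂ B = 1, 2, 3, 4, ≥ 5` — Diamond–Kramer's table as quoted by
Ribet 1997 §2 pp. 10–11, i.e. vKM's `ord₂(N_E) = 𝔢 + 1` with
`𝔢 = 4, 2, 2, −1, 0`. [cite: DiamondKramer1995] [cite: VonkanelMatschke2023, §10.4 (eq:refinedcondbound)] -/
theorem factorization_two_conductorNorm_freyCurve_normalised (hAB : IsCoprime A B)
    (h0 : A * B * (A + B) ≠ 0) (hA : A ≡ -1 [ZMOD 4]) (hB : (2 : ℤ) ∣ B) :
    ((freyCurve A B).conductorNorm ℤ).factorization 2 =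
      (if padicValNat 2 B.natAbs = 1 then 5 else if padicValNat 2 B.natAbs ≤ 3 then 3
        else if padicValNat 2 B.natAbs = 4 then 0 else 1) := by
  have hB0 : B ≠ 0 := fun h ↦ h0 (by rw [h]; ring)
  have hA2 : ¬ (2 : ℤ) ∣ A := not_two_dvd_of_mod hA
  have h1 : 1 ≤ padicValNat 2 B.natAbs := (two_pow_dvd_iff hB0 1).mp (by simpa using hB)
  by_cases h4 : (4 : ℤ) ∣ B
  · have h2 : 2 ≤ padicValNat 2 B.natAbs := (two_pow_dvd_iff hB0 2).mp (by simpa using h4)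
    rw [if_neg (by omega)]
    by_cases h16 : (16 : ℤ) ∣ B
    · have h4' : 4 ≤ padicValNat 2 B.natAbs := (two_pow_dvd_iff hB0 4).mp (by simpa using h16)
      rw [if_neg (by omega)]
      by_cases h32 : (32 : ℤ) ∣ B
      · have h5 : 5 ≤ padicValNat 2 B.natAbs := (two_pow_dvd_iff hB0 5).mp (by simpa using h32)
        rw [if_neg (by omega)]
        exact factorization_two_conductorNorm_freyCurve_of_thirtytwo_dvd hAB h0 hA h32
      · have h5 : ¬ 5 ≤ padicValNat 2 B.natAbs := fun h ↦
          h32 (by simpa using (two_pow_dvd_iff hB0 5).mpr h)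
        rw [if_pos (by omega)]
        exact factorization_two_conductorNorm_freyCurve_of_sixteen_dvd hAB h0 hA h16 h32
    · have h4' : ¬ 4 ≤ padicValNat 2 B.natAbs := fun h ↦
        h16 (by simpa using (two_pow_dvd_iff hB0 4).mpr h)
      rw [if_pos (by omega)]
      exact factorization_two_conductorNorm_freyCurve_of_four_dvd h0 hA h4 h16
  · have h2 : ¬ 2 ≤ padicValNat 2 B.natAbs := fun h ↦
      h4 (by simpa using (two_pow_dvd_iff hB0 2).mpr h)
    rw [if_pos (by omega)]
    exact factorization_two_conductorNorm_freyCurve_of_not_four_dvd h0 hA2 hB h4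

/-! ### `N_E ∣ 2⁴ rad(ABC)` -/

/-- **`N(E_{A,B}) ∣ 2⁴ rad(AB(A+B))`** for `A, B` coprime, `AB(A+B) ≠ 0`, `A ≡ −1 (mod 4)`, `B` even
(vKM, proof of Lemma 10.5: "[Diamond–Kramer] give that the conductor `N_E` of `E` divides
`2⁴ rad(abc)`"): `N ∣ 2⁸ rad` (`conductorNorm_freyCurve_dvd_holds`) and `ord₂ N ≤ 5 = 4 + ord₂ rad`.
[cite: VonkanelMatschke2023, Lemma 10.5 (proof, arXiv §10.4 p. 59)] [cite: DiamondKramer1995] -/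
theorem conductorNorm_freyCurve_dvd_two_pow_four_mul_radical (hAB : IsCoprime A B)
    (h0 : A * B * (A + B) ≠ 0) (hA : A ≡ -1 [ZMOD 4]) (hB : (2 : ℤ) ∣ B) :
    (freyCurve A B).conductorNorm ℤ ∣ 2 ^ 4 * radical (A * B * (A + B)).natAbs := by
  haveI := isElliptic_freyCurve h0
  have h8 := conductorNorm_freyCurve_dvd_holds A B hAB h0
  rw [natAbs_radical] at h8
  have hN0 : (freyCurve A B).conductorNorm ℤ ≠ 0 := (conductorNorm_pos_holds (freyCurve A B)).ne'
  have hr0 : radical (A * B * (A + B)).natAbs ≠ 0 := radical_ne_zero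
  have h2r : (radical (A * B * (A + B)).natAbs).factorization 2 = 1 :=
    factorization_two_radical (Int.natAbs_ne_zero.mpr h0)
      (Int.ofNat_dvd_left.mp (dvd_mul_of_dvd_left (dvd_mul_of_dvd_right hB _) _))
  have h5 := factorization_two_conductorNorm_freyCurve_le_five hAB h0 hA hB
  rw [← Nat.factorization_le_iff_dvd hN0 (mul_ne_zero (pow_ne_zero _ two_ne_zero) hr0)]
  have h8' := (Nat.factorization_le_iff_dvd hN0 (mul_ne_zero (pow_ne_zero _ two_ne_zero) hr0)).mpr h8
  intro p
  have h8p := h8' p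
  simp only [Nat.factorization_mul (pow_ne_zero _ two_ne_zero) hr0, Finsupp.add_apply,
    Nat.Prime.factorization_pow Nat.prime_two, Finsupp.single_apply] at h8p ⊢
  by_cases hp : (2 : ℕ) = p
  · subst hp
    rw [if_pos rfl, h2r]
    omega
  · rw [if_neg hp] at h8p ⊢
    exact h8p

/-! ### The minimal discriminant: `Δ_E = 2⁴(ABC)²` or `2⁻⁸(ABC)²` -/

/-- **`Δ_min(E_{A,B}) = 2⁴ (AB(A+B))²` when `16 ∤ AB(A+B)`** (`A, B` coprime, `AB(A+B) ≠ 0`): B–G's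
equation (12.17) is then globally minimal (`isMinimalAt_freyIntModel`). This is vKM's
"`Δ_E = Δ` if `ord₂(abc) ≤ 3`". [cite: VonkanelMatschke2023, Lemma 10.5 (proof, arXiv §10.4 p. 59)]
[cite: BombieriGubler2006, Ex. 12.5.10] -/
theorem minimalDiscriminantNorm_freyCurve_of_not_sixteen_dvd (hAB : IsCoprime A B)
    (h0 : A * B * (A + B) ≠ 0) (h16 : ¬ (16 : ℤ) ∣ A * B * (A + B)) :
    (freyCurve A B).minimalDiscriminantNorm ℤ = 2 ^ 4 * (A * B * (A + B)).natAbs ^ 2 := by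
  haveI := isElliptic_freyIntModel h0
  rw [← baseChange_freyIntModel, minimalDiscriminantNorm_eq_natAbs_holds (freyIntModel A B)
    (Δ_ne_zero_of_isElliptic_baseChange_int _) (isMinimalAt_freyIntModel hAB h0 h16), freyIntModel_Δ,
    Int.natAbs_mul, Int.natAbs_pow]
  rfl

/-- **`2⁸ Δ_min(E_{A,B}) = (AB(A+B))²` when `16 ∣ B`** (`A ≡ −1 (mod 4)`, `A, B` coprime,
`AB(A+B) ≠ 0`): B–G's equation (12.18) is globally minimal with `Δ = (AB/16)²(A+B)²` — the tree's
`minimalDiscriminantNorm_freyCurve_of_mod_holds` with `32 ∣ B` relaxed to `16 ∣ B` (same proof). This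
is vKM's "`Δ_E = 2⁻⁸(abc)²` if `ord₂(abc) ≥ 4`". [cite: VonkanelMatschke2023, Lemma 10.5 (proof, arXiv §10.4 p. 59)]
[cite: BombieriGubler2006, Ex. 12.5.10 (a)] -/
theorem two_pow_eight_mul_minimalDiscriminantNorm_freyCurve_of_sixteen_dvd (hAB : IsCoprime A B)
    (h0 : A * B * (A + B) ≠ 0) (hA : A ≡ -1 [ZMOD 4]) (h16 : (16 : ℤ) ∣ B) :
    2 ^ 8 * (freyCurve A B).minimalDiscriminantNorm ℤ = (A * B * (A + B)).natAbs ^ 2 := by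
  have h4 := four_dvd_sub hA h16
  have h16' : 16 ∣ A * B := dvd_mul_of_dvd_right h16 _
  haveI := isElliptic_freyIntModel₂ h0 h4 h16'
  have hC := smul_freyCurve_eq_baseChange_freyIntModel₂ h4 h16'
  set C : VariableChange ℚ := ⟨Units.mk0 (2 : ℚ) two_ne_zero, 0, 1, 0⟩
  have hinv : (C • freyCurve A B).minimalDiscriminantNorm ℤ = (freyCurve A B).minimalDiscriminantNorm ℤ := by
    simp only [minimalDiscriminantNorm, minimalDiscriminantIdeal, ordMinimalDiscriminant_smul_holds _ _ C]
  rw [← hinv, hC, minimalDiscriminantNorm_eq_natAbs_holds (freyIntModel₂ A B)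
    (Δ_ne_zero_of_isElliptic_baseChange_int (freyIntModel₂ A B))
    (isMinimalAt_freyIntModel₂ hAB (four_dvd_add_one hA) h16), freyIntModel₂_Δ h4 h16']
  obtain ⟨e, he⟩ := h16'
  have he' : A * B / 16 = e := by rw [he]; simp
  rw [he', ← Int.natAbs_pow (A * B * (A + B)) 2,
    show (A * B * (A + B)) ^ 2 = 2 ^ 8 * (e ^ 2 * (A + B) ^ 2) by rw [he]; ring, Int.natAbs_mul,
    Int.natAbs_pow]
  simp [Int.natAbs_mul, Int.natAbs_pow]

/-- **vKM's dichotomy for `Δ_E`** (`A, B` coprime, `AB(A+B) ≠ 0`, `A ≡ −1 (mod 4)`, `B` even):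
`Δ_min = 2⁴(AB(A+B))²` or `2⁸ Δ_min = (AB(A+B))²` ("`Δ_E = 2ⁿ(abc)²` with `n ∈ {4, −8}`").
[cite: VonkanelMatschke2023, Lemma 10.5 (arXiv §10.4, lem:psu2)] -/
theorem minimalDiscriminantNorm_freyCurve_normalised (hAB : IsCoprime A B)
    (h0 : A * B * (A + B) ≠ 0) (hA : A ≡ -1 [ZMOD 4]) (hB : (2 : ℤ) ∣ B) :
    (freyCurve A B).minimalDiscriminantNorm ℤ = 2 ^ 4 * (A * B * (A + B)).natAbs ^ 2 ∨
      2 ^ 8 * (freyCurve A B).minimalDiscriminantNorm ℤ = (A * B * (A + B)).natAbs ^ 2 := by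
  by_cases h16 : (16 : ℤ) ∣ B
  · exact Or.inr (two_pow_eight_mul_minimalDiscriminantNorm_freyCurve_of_sixteen_dvd hAB h0 hA h16)
  · refine Or.inl (minimalDiscriminantNorm_freyCurve_of_not_sixteen_dvd hAB h0 fun h ↦ h16 ?_)
    -- `16 ∣ AB(A+B)` with `A`, `A + B` odd forces `16 ∣ B`
    have hB0 : B ≠ 0 := fun h' ↦ h0 (by rw [h']; ring)
    have hv := padicValNat_natAbs_prod_eq h0 (not_two_dvd_of_mod hA) hB
    have h4 : 4 ≤ padicValNat 2 (A * B * (A + B)).natAbs :=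
      (two_pow_dvd_iff h0 4).mp (by simpa using h)
    rw [hv] at h4
    simpa using (two_pow_dvd_iff hB0 4).mpr h4

end Normalised

end Literature.NumberTheory.EllipticCurves

end
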